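import Summits.ResolutionOfSingularities.ResolutionOfSingularities.Theorems.EquisingularLiftEquisingularLiftNatNDInvPersists
import Summits.ResolutionOfSingularities.ResolutionOfSingularities.Theorems.EquisingularLiftEquisingularLiftNatNDRoundPropsP
import HarnessLib

/-!
# [OURS · L1 W4.5(b) · EL♮(3)] (L-δ) `ND.ndInvPersists₀ : ND.NDInvPersists₀ n k` — persistence of the POINTWISE downstairs invariant `NDInvP` through one round
# (desk R36 WIDTH TABLE D2 «K-LOC» / D2 UPDATE 2026-08-28T16:31:10Z / NAMES-FINAL 16:40:01Z; re-land of res-L1-w45b-lead-2's ✓ p640760 `ND.ndInvPersists`)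

Cell `res-hironaka`, rung L, slot W4.5(b), width seat `res-L1-w45b-nose-w4` (row (L-δ)); crux CHILD EL♮(3) = stmt-ResolutionOfSingularities-20148 (K6 / ND-LEAVES
programme, the 38th's closing kit (L-Ω) by the text owner). OURS · counted 0 · AI-written, weaker than expert review; nothing of [Hironaka2017] asserted; NOT a
statement of the manuscript; resolution of singularities in positive characteristic is NOT proved here. Def-free; statement = the tree port's
`ND.NDInvPersists₀` (✓ `…NatNDRoundPropsP` 252c9bfb1fe4d1d7 = SPEC K6-loc v2 §L0 verbatim) BY NAME.  `--supports stmt-ResolutionOfSingularities-20148 --as helper`.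

CONTENT (≤ 3-line edit of ✓ p640760, as priced by the K-REG AUDIT): `NDInvPersists₀` is `NDInvPersists` with the invariant `NDInv` replaced by the pointwise `NDInvP`
(the ambient clause `IsRegular F` deleted) and the binder `IsRegular F₉ →` deleted.  The proof is lead-2's, token for token, minus the two occurrences of the ambient
datum (`obtain ⟨_, S, …⟩` ↦ `obtain ⟨S, …⟩`, `refine ⟨hreg₉, S₉, …⟩` ↦ `refine ⟨S₉, …⟩`): off the blown-up point `x` the round `β ≫ υ` is an isomorphism onto `{x}ᶜ`,
so the other non-regular points of the reduced closure of `T₁` and their local ND frame data move along it (p640760's `existsUnique_preimage_of_isIso_restrict_compl`,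
`isRegularLocalRing_subscheme_stalk_iff_of_isIso_restrict_compl`, `isNDFrameAt_comap_of_isIso_restrict_compl`, `mem_of_mem_closure_of_ne`, imported BY NAME);
over `x` the END clause makes every point of the new reduced closure regular; hence `NDInvP (m+1)` becomes `NDInvP m`.
-/

set_option linter.dupNamespace false

noncomputable section

open CategoryTheory CategoryTheory.Limits AlgebraicGeometry TopologicalSpace Topology
open MvPolynomial
open Literature.AlgebraicGeometry.Resolution
open AlgebraicGeometry.Scheme.IdealSheafData

namespace Summit.ResolutionOfSingularities.ResolutionOfSingularities.Cruxes.EquisingularLiftNat.Sections.ND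

open Summit.ResolutionOfSingularities.ResolutionOfSingularities.Cruxes.EquisingularLiftNat.Sections

section Main

/-- **(L-δ) `ndInvPersists₀ : NDInvPersists₀ n k`** — the POINTWISE downstairs invariant `NDInvP` PERSISTS through one round: off the blown-up point `x` the round
`β ≫ υ` is an isomorphism onto `{x}ᶜ`, so the other non-regular points of the reduced closure and their local ND frame data move along it; over `x` the END clause
makes every point of the new reduced closure regular; hence the non-regular set drops from `m + 1` points to `m`.  Re-land of res-L1-w45b-lead-2's ✓ p640760
`ndInvPersists` with the ambient-regularity datum deleted (desk K-REG ruling (i) LOCALISE). [OURS · L1 W4.5b · D2 brick (L-δ); PROVED] -/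
theorem ndInvPersists₀ (n : ℕ) (k : Type) [Field k] : NDInvPersists₀ n k := by
  classical
  intro m F₁ ρ T₁ hND x hx hxz F₂ υ hυ F₉ β T₉ hT₉ hend hiso hbook
  obtain ⟨S, hcard, hiff, hS⟩ := hND
  obtain ⟨z₀, hz₀x, hz₀⟩ := hxz
  have hxS : x ∈ S := by
    by_contra h
    exact hz₀ ((hiff z₀).mpr (by rw [hz₀x]; exact h))
  haveI := hiso
  -- unique preimages off `x`
  have hpre : ∀ x' ∈ S.erase x, ∃! y : F₉, (β ≫ υ) y = x' := fun x' hx' =>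
    existsUnique_preimage_of_isIso_restrict_compl (β ≫ υ) x hx x' (Finset.ne_of_mem_erase hx')
  let φ : ↥(S.erase x) → F₉ := fun p => (hpre p.1 p.2).choose
  have hφ : ∀ p : ↥(S.erase x), (β ≫ υ) (φ p) = p.1 := fun p => (hpre p.1 p.2).choose_spec.1
  have hφuniq : ∀ (p : ↥(S.erase x)) (y : F₉), (β ≫ υ) y = p.1 → y = φ p := fun p y hy =>
    (hpre p.1 p.2).unique hy (hφ p)
  have hφinj : Function.Injective φ := by
    intro p q h
    apply Subtype.ext
    rw [← hφ p, ← hφ q, h]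
  let S₉ : Finset F₉ := (S.erase x).attach.image φ
  have hmem : ∀ y : F₉, y ∈ S₉ ↔ (β ≫ υ) y ≠ x ∧ (β ≫ υ) y ∈ S := by
    intro y
    constructor
    · intro hy
      obtain ⟨p, -, rfl⟩ := Finset.mem_image.mp hy
      rw [hφ p]
      exact ⟨Finset.ne_of_mem_erase p.2, Finset.mem_of_mem_erase p.2⟩
    · rintro ⟨hyx, hyS⟩
      have hp : (β ≫ υ) y ∈ S.erase x := Finset.mem_erase.mpr ⟨hyx, hyS⟩
      have : y = φ ⟨_, hp⟩ := hφuniq ⟨_, hp⟩ y rfl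
      rw [this]
      exact Finset.mem_image.mpr ⟨⟨_, hp⟩, Finset.mem_attach _ _, rfl⟩
  refine ⟨S₉, ?_, ?_, ?_⟩
  · -- the count drops by one
    rw [Finset.card_image_of_injective _ hφinj, Finset.card_attach, Finset.card_erase_of_mem hxS, hcard]
    rfl
  · -- regular ⟺ not recorded
    intro z₉
    by_cases hyx : (β ≫ υ) ((vanishingIdeal (⟨closure T₉, isClosed_closure⟩ : Closeds F₉)).subschemeι z₉) = x
    · refine iff_of_true (hend z₉ hyx) ?_
      intro h
      exact ((hmem _).mp h).1 hyx
    · -- off `x`: the point comes from a point of the reduced closure of `T₁`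
      have hyT₉ : ((vanishingIdeal (⟨closure T₉, isClosed_closure⟩ : Closeds F₉)).subschemeι z₉ : F₉) ∈ closure T₉ :=
        (Set.ext_iff.mp (range_subschemeι_vanishingIdeal_closure T₉) _).mp ⟨z₉, rfl⟩
      have hyT₉' := hT₉.closure_subset hyT₉
      have hfy : (β ≫ υ) ((vanishingIdeal (⟨closure T₉, isClosed_closure⟩ : Closeds F₉)).subschemeι z₉) ∈ T₁ \ {x} := by
        have : ((vanishingIdeal (⟨closure T₉, isClosed_closure⟩ : Closeds F₉)).subschemeι z₉ : F₉) ∈ T₉ ∩ (β ≫ υ) ⁻¹' {x}ᶜ := ⟨hyT₉', hyx⟩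
        rwa [hbook] at this
      obtain ⟨z, hz⟩ : ∃ z : ↥(vanishingIdeal (⟨closure T₁, isClosed_closure⟩ : Closeds F₁)).subscheme,
          (vanishingIdeal (⟨closure T₁, isClosed_closure⟩ : Closeds F₁)).subschemeι.base z =
            (β ≫ υ) ((vanishingIdeal (⟨closure T₉, isClosed_closure⟩ : Closeds F₉)).subschemeι z₉) := by
        have : (β ≫ υ) ((vanishingIdeal (⟨closure T₉, isClosed_closure⟩ : Closeds F₉)).subschemeι z₉) ∈
            Set.range (vanishingIdeal (⟨closure T₁, isClosed_closure⟩ : Closeds F₁)).subschemeι.base := by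
          rw [range_subschemeι_vanishingIdeal_closure T₁]; exact subset_closure hfy.1
        exact this
      rw [isRegularLocalRing_subscheme_stalk_iff_of_isIso_restrict_compl (β ≫ υ) x hx T₁ T₉ hT₉ hbook _ hyx z₉ rfl z hz, hiff z,
        hmem]
      push Not
      constructor
      · intro h _; rw [← hz]; exact h
      · intro h; rw [hz] at *; exact h hyx
  · -- the recorded points: over the old ones, closed, with transported ND frame data
    intro y₉ hy₉
    obtain ⟨hyx, hyS⟩ := (hmem y₉).mp hy₉
    obtain ⟨⟨z, hz⟩, hx'cl, W, hW⟩ := hS _ hyS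
    -- the old point lies in `T₁` (it is in the closure and is not `x`)
    have hx'T : (β ≫ υ) y₉ ∈ T₁ := by
      have hcl : (β ≫ υ) y₉ ∈ closure T₁ := by
        rw [← range_subschemeι_vanishingIdeal_closure T₁]; exact ⟨z, hz⟩
      exact mem_of_mem_closure_of_ne (β ≫ υ) x hx T₁ T₉ hT₉ hbook hcl hyx
    have hyT₉ : y₉ ∈ T₉ := by
      have : y₉ ∈ (β ≫ υ) ⁻¹' (T₁ \ {x}) := ⟨hx'T, hyx⟩
      rw [← hbook] at this
      exact this.1
    refine ⟨?_, ?_, fun j => (W j).comap (β ≫ υ), isNDFrameAt_comap_of_isIso_restrict_compl (β ≫ υ) x hx ρ T₁ T₉ hT₉ hbook y₉ hyx W hW⟩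
    · have : y₉ ∈ Set.range (vanishingIdeal (⟨closure T₉, isClosed_closure⟩ : Closeds F₉)).subschemeι.base := by
        rw [range_subschemeι_vanishingIdeal_closure T₉]; exact subset_closure hyT₉
      obtain ⟨z₉, hz₉⟩ := this
      exact ⟨z₉, hz₉⟩
    · -- `{y₉} = (β ≫ υ)⁻¹ {x'}` is closed
      have : ({y₉} : Set F₉) = (β ≫ υ) ⁻¹' {(β ≫ υ) y₉} := by
        ext y
        simp only [Set.mem_singleton_iff, Set.mem_preimage]
        constructor
        · rintro rfl; rfl
        · intro hy
          have hp : (β ≫ υ) y₉ ∈ S.erase x := Finset.mem_erase.mpr ⟨hyx, hyS⟩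
          exact (hφuniq ⟨_, hp⟩ y hy).trans (hφuniq ⟨_, hp⟩ y₉ rfl).symm
      rw [this]
      exact hx'cl.preimage (β ≫ υ).continuous

end Main

end Summit.ResolutionOfSingularities.ResolutionOfSingularities.Cruxes.EquisingularLiftNat.Sections.ND

end
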